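import Mathlib.Analysis.Complex.Norm
import Mathlib.Topology.MetricSpace.Sequences
import Literature.Geometry.Lorentzian.KerrSchild
import HarnessLib

/-!
# The phase window of the Kerr Weyl scalar `Ψ₂ = −M/(r − i a cos θ)³`

Elementary complex algebra (everything proved; no definition) behind curvature-phase rigidity
arguments for the Kerr family (Kerr is Petrov type D with Weyl scalar `Ψ₂ = −M/(r − i a cos θ)³`,
Kinnersley 1969; Chandrasekhar 1983, §58): the values `M/(r − ib)³`, `r ≥ r₊(M,a)`, `|b| ≤ |a|`
(`b = a cos θ`), of a SUB-EXTREMAL exterior lie in the closed double sector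
`|arg| ≤ 3 arctan(|a|/r₊) < 135°`, while the value `M'/(r' − iM')³` of an EXTREMAL background at a
polar near-horizon point, `κ r' < M' < r'` (`κ = |a|/r₊`), has argument in `(3 arctan κ, 135°]`;
the separation is made quantitative with the `1`-Lipschitz functionals `Im` and
`z ↦ Im((1 − iκ)³ z)/‖(1 − iκ)³‖` (no `Complex.arg` needed): `psi2_separation`. The
orientation-free variant: the two REAL invariants `(Re Ψ₂², Re Ψ₂³)` determine `Ψ₂` up to
conjugation where `Re Ψ₂² < 0` (`eq_or_eq_conj_of_re_sq_of_re_cube`), and a bounded sequence whose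
`(Re z², Re z³)` converge to those of such a target while staying `ε`-far from it and its conjugate
does not exist (`false_of_tendsto_re_sq_re_cube`).

## References

* S. Chandrasekhar, *The mathematical theory of black holes*, Oxford 1983, §58 (`Ψ₂` of Kerr).
* B. O'Neill, *The geometry of Kerr black holes*, A K Peters 1995, Ch. 2, §2.3 (key `ONeill1995`).
-/

noncomputable section

open Filter Topology
open Literature.Geometry.Lorentzian

namespace Literature.Geometry.Lorentzian

namespace WeylPhase

/-! ### Phase-window algebra for the Weyl scalar `Ψ₂ = −M/(r − i a cos θ)³`

Pure complex algebra behind the contradiction of the stub: the values `M/(r − ib)³`, `r ≥ r₊(M,a)`,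
`|b| ≤ |a|` (`b = a cos θ`), of sub-extremal Kerr lie in the closed double sector
`|arg| ≤ 3 arctan(|a|/r₊) < 135°`, while the extremal polar near-horizon value `M'/(r' − iM')³`,
`κ r' < M' < r'` (`κ = |a|/r₊`), has argument in `(3 arctan κ, 135°]`; the separation is made
quantitative with the `1`-Lipschitz functionals `Im` and `z ↦ Im((1 − iκ)³ z)/‖(1 − iκ)³‖`, so no
`Complex.arg` is needed. A second, orientation-free route (`eq_or_eq_conj_of_re_sq_of_re_cube`):
the two REAL invariants `(Re Ψ₂², Re Ψ₂³)` determine `Ψ₂` up to conjugation where `Re Ψ₂² < 0`. -/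

section PhaseAlgebra

open Complex


/-- `Re (P + iQ)³ = P (P² − 3Q²)`. [folklore] -/
theorem re_cube (u : ℂ) : (u ^ 3).re = u.re * (u.re ^ 2 - 3 * u.im ^ 2) := by
  simp only [pow_succ, pow_zero, one_mul, Complex.mul_re, Complex.mul_im]; ring

/-- `Im (P + iQ)³ = Q (3P² − Q²)`. [folklore] -/
theorem im_cube (u : ℂ) : (u ^ 3).im = u.im * (3 * u.re ^ 2 - u.im ^ 2) := by
  simp only [pow_succ, pow_zero, one_mul, Complex.mul_re, Complex.mul_im]; ring

/-- Real part of the rotated number `(1 − iκ) u`. [folklore] -/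
theorem rot_re (κ : ℝ) (u : ℂ) : ((1 - κ * I) * u).re = u.re + κ * u.im := by
  simp [Complex.mul_re]

/-- Imaginary part of the rotated number `(1 − iκ) u`. [folklore] -/
theorem rot_im (κ : ℝ) (u : ℂ) : ((1 - κ * I) * u).im = u.im - κ * u.re := by
  simp [Complex.mul_im]; ring

/-- **The sub-extremal sector, upper half**: for `u = P + iQ` with `P > 0`, `0 ≤ Q ≤ κP`,
`κ < 1`, the cube of the rotated number `(1 − iκ)u` has nonpositive imaginary part
(`arg u³ ≤ 3 arctan κ`). [folklore] -/
theorem im_rot_cube_nonpos {κ : ℝ} (hκ0 : 0 ≤ κ) (hκ1 : κ < 1) {u : ℂ} (hu : 0 < u.re)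
    (hq : u.im ≤ κ * u.re) (hq0 : 0 ≤ u.im) : (((1 - κ * I) * u) ^ 3).im ≤ 0 := by
  rw [im_cube, rot_re, rot_im]
  have hQ : u.im - κ * u.re ≤ 0 := by linarith
  have hκu : κ * u.re < u.re := by nlinarith
  have hP : u.re ≤ u.re + κ * u.im := by nlinarith [mul_nonneg hκ0 hq0]
  have hQ2 : (u.im - κ * u.re) ^ 2 ≤ (κ * u.re) ^ 2 := by nlinarith [mul_nonneg hκ0 hu.le]
  have hK2 : (κ * u.re) ^ 2 ≤ u.re ^ 2 := by nlinarith [mul_nonneg hκ0 hu.le]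
  have hP2 : u.re ^ 2 ≤ (u.re + κ * u.im) ^ 2 := by nlinarith
  have h3 : 0 ≤ 3 * (u.re + κ * u.im) ^ 2 - (u.im - κ * u.re) ^ 2 := by nlinarith
  exact mul_nonpos_of_nonpos_of_nonneg hQ h3

/-- **The sub-extremal sector, lower half**: for `u = P + iQ` with `P > 0`, `−P < Q ≤ 0`, the
cube `u³` has nonpositive imaginary part. [folklore] -/
theorem im_cube_nonpos {u : ℂ} (hu : 0 < u.re) (hq : -u.re < u.im) (hq0 : u.im ≤ 0) :
    (u ^ 3).im ≤ 0 := by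
  rw [im_cube]
  have h3 : 0 ≤ 3 * u.re ^ 2 - u.im ^ 2 := by nlinarith
  exact mul_nonpos_of_nonpos_of_nonneg hq0 h3

/-- **The extremal near-horizon polar target lies strictly above the sector**: for
`u' = P' + iQ'` with `0 ≤ κ`, `κP' < Q' ≤ P'`, both `Im u'³ > 0` and `Im ((1 − iκ)u')³ > 0`
(`3 arctan κ < arg u'³ ≤ 135°`). [folklore] -/
theorem im_cube_target_pos {κ : ℝ} (hκ0 : 0 ≤ κ) {u' : ℂ} (hu' : 0 < u'.re)
    (h1 : κ * u'.re < u'.im) (h2 : u'.im ≤ u'.re) :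
    0 < (u' ^ 3).im ∧ 0 < (((1 - κ * I) * u') ^ 3).im := by
  have hq' : 0 < u'.im := lt_of_le_of_lt (mul_nonneg hκ0 hu'.le) h1
  constructor
  · rw [im_cube]
    exact mul_pos hq' (by nlinarith)
  · rw [im_cube, rot_re, rot_im]
    have hQ : 0 < u'.im - κ * u'.re := by linarith
    refine mul_pos hQ ?_
    nlinarith [mul_nonneg hκ0 hq'.le, mul_nonneg hκ0 hu'.le]

/-- `‖(1 − iκ)³‖ ≤ 8` for `0 ≤ κ < 1`. [folklore] -/
theorem norm_rot_cube_le {κ : ℝ} (hκ0 : 0 ≤ κ) (hκ1 : κ < 1) : ‖(1 - κ * I : ℂ) ^ 3‖ ≤ 8 := by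
  rw [norm_pow]
  have h1 : ‖(1 - κ * I : ℂ)‖ ≤ 2 := by
    calc ‖(1 - κ * I : ℂ)‖ ≤ ‖(1 : ℂ)‖ + ‖(κ * I : ℂ)‖ := norm_sub_le _ _
      _ ≤ 1 + 1 := by
        rw [norm_one, norm_mul, Complex.norm_I, mul_one, Complex.norm_real, Real.norm_eq_abs,
          abs_of_nonneg hκ0]
        linarith
      _ = 2 := by norm_num
  calc ‖(1 - κ * I : ℂ)‖ ^ 3 ≤ 2 ^ 3 := by gcongr
    _ = 8 := by norm_num

/-- **Separation of the target from the sector (quantitative phase window).** For `0 ≤ κ < 1`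
and a target `t = l' u'³`, `l' > 0`, `u' = P' + iQ'` with `κP' < Q' ≤ P'`, there is `ε > 0`
with `‖l u³ − t‖ ≥ ε` for every `l ≥ 0` and every `u = P + iQ` in the sector `P > 0`,
`|Q| ≤ κP`: on the upper half the `ℝ`-linear functional `z ↦ Im((1 − iκ)³ z)` is `≤ 0` on the
sector values and `> 0` at `t`; on the lower half `Im` itself separates. [folklore] -/
theorem sector_separation {κ : ℝ} (hκ0 : 0 ≤ κ) (hκ1 : κ < 1) {u' : ℂ} (hu' : 0 < u'.re)
    (h1 : κ * u'.re < u'.im) (h2 : u'.im ≤ u'.re) {l' : ℝ} (hl' : 0 < l') :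
    ∃ ε : ℝ, 0 < ε ∧ ∀ (l : ℝ) (u : ℂ), 0 ≤ l → 0 < u.re → |u.im| ≤ κ * u.re →
      ε ≤ ‖(l : ℂ) * u ^ 3 - (l' : ℂ) * u' ^ 3‖ := by
  obtain ⟨hT1, hT2⟩ := im_cube_target_pos hκ0 hu' h1 h2
  set α : ℂ := (1 - κ * I) ^ 3 with hα
  set t : ℂ := (l' : ℂ) * u' ^ 3 with ht
  have hαt : (α * t).im = l' * (((1 - κ * I) * u') ^ 3).im := by
    rw [ht, hα, show (1 - κ * I) ^ 3 * ((l' : ℂ) * u' ^ 3) =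
      (l' : ℂ) * (((1 - κ * I) * u') ^ 3) by ring, im_ofReal_mul]
  have htim : t.im = l' * (u' ^ 3).im := by rw [ht, im_ofReal_mul]
  have hA : 0 < (α * t).im := by rw [hαt]; exact mul_pos hl' hT2
  have hB : 0 < t.im := by rw [htim]; exact mul_pos hl' hT1
  refine ⟨min ((α * t).im / 8) t.im, lt_min (by positivity) hB, fun l u hl hu hq ↦ ?_⟩
  have hαn : ‖α‖ ≤ 8 := norm_rot_cube_le hκ0 hκ1
  rcases le_total 0 u.im with hq0 | hq0
  · -- upper half: the rotated functional separates
    have hz : (α * ((l : ℂ) * u ^ 3)).im ≤ 0 := by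
      rw [hα, show (1 - κ * I) ^ 3 * ((l : ℂ) * u ^ 3) = (l : ℂ) * (((1 - κ * I) * u) ^ 3) by ring,
        im_ofReal_mul]
      exact mul_nonpos_of_nonneg_of_nonpos hl
        (im_rot_cube_nonpos hκ0 hκ1 hu ((le_abs_self _).trans hq) hq0)
    have hdiff : (α * t).im - (α * ((l : ℂ) * u ^ 3)).im ≤ 8 * ‖(l : ℂ) * u ^ 3 - t‖ := by
      have h := im_le_norm (α * (t - (l : ℂ) * u ^ 3))
      rw [norm_mul, norm_sub_rev] at h
      have h' : (α * (t - (l : ℂ) * u ^ 3)).im = (α * t).im - (α * ((l : ℂ) * u ^ 3)).im := by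
        rw [mul_sub, Complex.sub_im]
      rw [h'] at h
      exact h.trans (mul_le_mul_of_nonneg_right hαn (norm_nonneg _))
    calc min ((α * t).im / 8) t.im ≤ (α * t).im / 8 := min_le_left _ _
      _ ≤ ‖(l : ℂ) * u ^ 3 - t‖ := by linarith
  · -- lower half: `Im` separates
    have hlow : -u.re < u.im := by
      have : |u.im| < u.re := lt_of_le_of_lt hq (by nlinarith)
      linarith [neg_abs_le u.im]
    have hz : ((l : ℂ) * u ^ 3).im ≤ 0 := by
      rw [im_ofReal_mul]
      exact mul_nonpos_of_nonneg_of_nonpos hl (im_cube_nonpos hu hlow hq0)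
    have hdiff : t.im - ((l : ℂ) * u ^ 3).im ≤ ‖(l : ℂ) * u ^ 3 - t‖ := by
      have h := im_le_norm (t - (l : ℂ) * u ^ 3)
      rwa [Complex.sub_im, norm_sub_rev] at h
    calc min ((α * t).im / 8) t.im ≤ t.im := min_le_right _ _
      _ ≤ ‖(l : ℂ) * u ^ 3 - t‖ := by linarith

/-- `c/(p − iq)³ = (c/(p² + q²)³) · (p + iq)³` for `(p, q) ≠ 0`: the Weyl-scalar value
`M/(r − i a cos θ)³` is a positive multiple of the cube `(r + i a cos θ)³`. [folklore] -/
theorem div_cube_eq (c p q : ℝ) (h : 0 < p ^ 2 + q ^ 2) :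
    (c : ℂ) / ((p : ℂ) - (q : ℂ) * I) ^ 3 =
      ((c / (p ^ 2 + q ^ 2) ^ 3 : ℝ) : ℂ) * ((p : ℂ) + (q : ℂ) * I) ^ 3 := by
  have hn : ((p ^ 2 + q ^ 2 : ℝ) : ℂ) = ((p : ℂ) - (q : ℂ) * I) * ((p : ℂ) + (q : ℂ) * I) := by
    push_cast
    ring_nf
    rw [Complex.I_sq]
    ring
  have hw : ((p : ℂ) - (q : ℂ) * I) ≠ 0 := by
    intro h0
    have : ((p ^ 2 + q ^ 2 : ℝ) : ℂ) = 0 := by rw [hn, h0, zero_mul]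
    exact h.ne' (by exact_mod_cast this)
  have hw' : ((p : ℂ) + (q : ℂ) * I) ≠ 0 := by
    intro h0
    have : ((p ^ 2 + q ^ 2 : ℝ) : ℂ) = 0 := by rw [hn, h0, mul_zero]
    exact h.ne' (by exact_mod_cast this)
  push_cast
  rw [show ((p : ℂ) ^ 2 + (q : ℂ) ^ 2) = ((p ^ 2 + q ^ 2 : ℝ) : ℂ) by push_cast; ring, hn]
  field_simp

/-- Complex conjugation of the Weyl-scalar value flips the sign of `a cos θ`:
`conj (c/(p − iq)³) = c/(p + iq)³`. [folklore] -/
theorem conj_div_cube (c p q : ℝ) :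
    (starRingEnd ℂ) ((c : ℂ) / ((p : ℂ) - (q : ℂ) * I) ^ 3) =
      (c : ℂ) / ((p : ℂ) - ((-q : ℝ) : ℂ) * I) ^ 3 := by
  simp only [map_div₀, map_pow, map_sub, map_mul, Complex.conj_ofReal, Complex.conj_I]
  push_cast
  ring_nf

/-- `Re (P + iQ)⁶ = (P² − Q²)(Q⁴ − 14P²Q² + P⁴)`. [folklore] -/
theorem re_pow_six (u : ℂ) :
    (u ^ 6).re = (u.re ^ 2 - u.im ^ 2) * (u.im ^ 4 - 14 * u.re ^ 2 * u.im ^ 2 + u.re ^ 4) := by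
  simp only [pow_succ, pow_zero, one_mul, Complex.mul_re, Complex.mul_im]; ring

/-- At the polar near-horizon target the square of the Weyl-scalar value has NEGATIVE real part:
for `u' = P' + iQ'` with `P'/2 ≤ Q' < P'` (phase of `u'` in `[arctan ½, 45°) ⊂ (15°, 45°)`),
`Re u'⁶ < 0`; so `eq_or_eq_conj_of_re_sq_of_re_cube` applies to `t = l' u'³` (`Re t² = l'² Re u'⁶`).
[folklore] -/
theorem re_pow_six_neg {u : ℂ} (hu : 0 < u.re) (h1 : u.re ≤ 2 * u.im) (h2 : u.im < u.re) :
    (u ^ 6).re < 0 := by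
  rw [re_pow_six]
  have him : 0 < u.im := by linarith
  have hA : 0 < u.re ^ 2 - u.im ^ 2 := by nlinarith
  have hQ : u.re ^ 2 ≤ 4 * u.im ^ 2 := by nlinarith
  have hB : u.im ^ 4 - 14 * u.re ^ 2 * u.im ^ 2 + u.re ^ 4 < 0 := by
    nlinarith [mul_nonneg (sub_nonneg.mpr hQ) hA.le, sq_nonneg u.re, sq_nonneg u.im,
      mul_pos hu him, pow_pos hu 2, pow_pos him 2]
  exact mul_neg_of_pos_of_neg hA hB


/-- `|a| < r₊` and `0 < r₊` for sub-extremal parameters `|a| < M` (`r₊ = M + √(M² − a²) ≥ M`).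
[folklore] -/
theorem abs_lt_rPlus {M a : ℝ} (ha : |a| < M) : |a| < Kerr.rPlus M a ∧ 0 < Kerr.rPlus M a := by
  have h1 : M ≤ Kerr.rPlus M a := by
    unfold Kerr.rPlus
    linarith [Real.sqrt_nonneg (M ^ 2 - a ^ 2)]
  exact ⟨ha.trans_le h1, ((abs_nonneg a).trans_lt ha).trans_le h1⟩

/-- **Phase-window separation, positive spin.** For sub-extremal `(M, a)` and `M' > 0` there are
a polar radius `r' ∈ (M', 2M']` and `ε > 0` such that the Weyl-scalar value
`M'/(r' − iM')³` of EXTREMAL Kerr `(M', a' = M')` at the polar-axis point of radius `r'` is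
`ε`-far from every value `M/(r − ib)³`, `r ≥ r₊(M, a)`, `|b| ≤ |a|` (`b = a cos θ`), of
sub-extremal Kerr `(M, a)` on `{r ≥ r₊}`: with `κ = |a|/r₊ < 1` and `r' = 2M'/(1 + κ)` one has
`κ r' < M' < r'`, and `sector_separation` applies to `u = r + ib`, `u' = r' + iM'`. [folklore] -/
theorem psi2_separation_pos {M a : ℝ} (ha : |a| < M) {M' : ℝ} (hM' : 0 < M') :
    ∃ r' : ℝ, M' < r' ∧ r' ≤ 2 * M' ∧
      (((M' : ℂ) / ((r' : ℂ) - (M' : ℂ) * I) ^ 3) ^ 2).re < 0 ∧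
      ∃ ε : ℝ, 0 < ε ∧ ∀ r b : ℝ, Kerr.rPlus M a ≤ r → |b| ≤ |a| →
      ε ≤ ‖(M : ℂ) / ((r : ℂ) - (b : ℂ) * I) ^ 3 - (M' : ℂ) / ((r' : ℂ) - (M' : ℂ) * I) ^ 3‖ := by
  obtain ⟨harp, hrp⟩ := abs_lt_rPlus ha
  have hM : 0 < M := (abs_nonneg a).trans_lt ha
  set κ : ℝ := |a| / Kerr.rPlus M a with hκ
  have hκ0 : 0 ≤ κ := div_nonneg (abs_nonneg a) hrp.le
  have hκ1 : κ < 1 := (div_lt_one hrp).mpr harp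
  have haκ : |a| = κ * Kerr.rPlus M a := by rw [hκ, div_mul_cancel₀ _ hrp.ne']
  set r' : ℝ := 2 * M' / (1 + κ) with hr'
  have h1κ : 0 < 1 + κ := by linarith
  have hr'1 : M' < r' := by
    rw [hr', lt_div_iff₀ h1κ]; nlinarith
  have hr'2 : κ * r' < M' := by
    rw [hr', mul_div_assoc', div_lt_iff₀ h1κ]; nlinarith
  have hr'3 : r' ≤ 2 * M' := by
    rw [hr', div_le_iff₀ h1κ]; nlinarith
  have hr'0 : 0 < r' := hM'.trans hr'1
  -- the target `t = l' u'³`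
  have hn' : 0 < r' ^ 2 + M' ^ 2 := by positivity
  have hl' : 0 < M' / (r' ^ 2 + M' ^ 2) ^ 3 := by positivity
  obtain ⟨ε, hε, hsep⟩ := sector_separation hκ0 hκ1 (u' := (r' : ℂ) + (M' : ℂ) * I)
    (by simpa using hr'0) (by simpa using hr'2) (by simpa using hr'1.le) hl'
  have hre : (((M' : ℂ) / ((r' : ℂ) - (M' : ℂ) * I) ^ 3) ^ 2).re < 0 := by
    have e6 : (((r' : ℂ) + (M' : ℂ) * I) ^ 3) ^ 2 = ((r' : ℂ) + (M' : ℂ) * I) ^ 6 := by ring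
    rw [div_cube_eq M' r' M' hn', mul_pow, ← Complex.ofReal_pow, e6, Complex.re_ofReal_mul]
    exact mul_neg_of_pos_of_neg (by positivity)
      (re_pow_six_neg (by simpa using hr'0) (by simpa using hr'3) (by simpa using hr'1))
  refine ⟨r', hr'1, hr'3, hre, ε, hε, fun r b hr hb ↦ ?_⟩
  have hr0 : 0 < r := hrp.trans_le hr
  have hn : 0 < r ^ 2 + b ^ 2 := by positivity
  have hl : 0 ≤ M / (r ^ 2 + b ^ 2) ^ 3 := by positivity
  have hbκ : |b| ≤ κ * r := by
    calc |b| ≤ |a| := hb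
      _ = κ * Kerr.rPlus M a := haκ
      _ ≤ κ * r := mul_le_mul_of_nonneg_left hr hκ0
  have h := hsep (M / (r ^ 2 + b ^ 2) ^ 3) ((r : ℂ) + (b : ℂ) * I) hl (by simpa using hr0)
    (by simpa using hbκ)
  rwa [div_cube_eq M r b hn, div_cube_eq M' r' M' hn']

/-- **Phase-window separation (both spins, both orientations).** For sub-extremal `(M, a)` and
extremal `(M', a')` (`|a'| = M' > 0`) there are a polar radius `r' ∈ (M', 2M']` and `ε > 0` such
that the extremal Weyl-scalar value `M'/(r' − i a')³` at the positive polar-axis point of radius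
`r'` (where `cos θ' = 1`) is `ε`-far from all sub-extremal values `M/(r − ib)³`, `r ≥ r₊(M, a)`,
`|b| ≤ |a|`; since `b` ranges over a symmetric interval, the same `ε` serves the complex-conjugate
convention (orientation reversal). The case `a' = −M'` is the conjugate of `a' = M'`
(`conj_div_cube`). [folklore] -/
theorem psi2_separation {M a : ℝ} (ha : |a| < M) {M' a' : ℝ} (hext : Kerr.IsExtremal M' a') :
    ∃ r' : ℝ, M' < r' ∧ r' ≤ 2 * M' ∧
      (((M' : ℂ) / ((r' : ℂ) - (a' : ℂ) * I) ^ 3) ^ 2).re < 0 ∧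
      ∃ ε : ℝ, 0 < ε ∧ ∀ r b : ℝ, Kerr.rPlus M a ≤ r → |b| ≤ |a| →
      ε ≤ ‖(M : ℂ) / ((r : ℂ) - (b : ℂ) * I) ^ 3 - (M' : ℂ) / ((r' : ℂ) - (a' : ℂ) * I) ^ 3‖ := by
  obtain ⟨r', hr'1, hr'2, hre, ε, hε, hsep⟩ := psi2_separation_pos ha hext.2
  rcases (abs_eq hext.2.le).mp hext.1 with ha' | ha'
  · subst ha'
    exact ⟨r', hr'1, hr'2, hre, ε, hε, fun r b hr hb ↦ hsep r b hr hb⟩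
  · refine ⟨r', hr'1, hr'2, ?_, ε, hε, fun r b hr hb ↦ ?_⟩
    · -- `a' = −M'`: the target is the conjugate, with the same `Re t²`
      have hc : (M' : ℂ) / ((r' : ℂ) - (a' : ℂ) * I) ^ 3 =
          (starRingEnd ℂ) ((M' : ℂ) / ((r' : ℂ) - (M' : ℂ) * I) ^ 3) := by
        rw [conj_div_cube, ha']
      rw [hc, ← map_pow, Complex.conj_re]
      exact hre
    · -- `a' = −M'`: conjugate
      have h := hsep r (-b) hr (by rwa [abs_neg])
      rw [← Complex.norm_conj, map_sub, conj_div_cube, conj_div_cube] at h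
      simpa [ha'] using h

/-- **Real-invariant rigidity**: the pair `(Re z², Re z³)` determines a complex number `z` up to
conjugation as soon as `Re z² < 0` at the target. With `z = Ψ₂` this says that the two REAL
polynomial curvature invariants `R_{abcd}R^{abcd} = 48 Re Ψ₂²` and
`R_{ab}{}^{cd}R_{cd}{}^{ef}R_{ef}{}^{ab} ∝ Re Ψ₂³` of a vacuum type-D metric (no Hodge dual, no
orientation) pin down `Ψ₂` up to `Ψ₂ ↦ conj Ψ₂` wherever `Re Ψ₂² < 0`. Proof: with `z = x + iy`,
`t = u + iv`, `A = u² − v² < 0`: `Re z³ = −2x³ + 3Ax` and `X ↦ −2X³ + 3AX` is injective for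
`A < 0`. [folklore] -/
theorem eq_or_eq_conj_of_re_sq_of_re_cube {z t : ℂ} (ht : (t ^ 2).re < 0)
    (h2 : (z ^ 2).re = (t ^ 2).re) (h3 : (z ^ 3).re = (t ^ 3).re) :
    z = t ∨ z = (starRingEnd ℂ) t := by
  have e2 : ∀ w : ℂ, (w ^ 2).re = w.re ^ 2 - w.im ^ 2 := fun w ↦ by
    rw [sq, Complex.mul_re]; ring
  have e3 : ∀ w : ℂ, (w ^ 3).re = w.re ^ 3 - 3 * w.re * w.im ^ 2 := fun w ↦ by
    rw [re_cube]; ring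
  rw [e2, e2] at h2
  rw [e3, e3] at h3
  rw [e2] at ht
  have key : (z.re - t.re) * (2 * z.re ^ 2 + 2 * z.re * t.re - t.re ^ 2 + 3 * t.im ^ 2) = 0 := by
    linear_combination (-1 : ℝ) * h3 + 3 * z.re * h2
  have hpos : 0 < 2 * z.re ^ 2 + 2 * z.re * t.re - t.re ^ 2 + 3 * t.im ^ 2 := by
    nlinarith [sq_nonneg (2 * z.re + t.re), sq_nonneg t.im, sq_nonneg t.re]
  have hre : z.re = t.re := by
    have := mul_eq_zero.mp key
    rcases this with h | h
    · linarith
    · exact absurd h hpos.ne'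
  have him : z.im ^ 2 = t.im ^ 2 := by rw [hre] at h2; linarith
  rcases sq_eq_sq_iff_eq_or_eq_neg.mp him with h | h
  · exact Or.inl (Complex.ext hre h)
  · exact Or.inr (Complex.ext (by simpa using hre) (by simpa using h))

/-- **The closed forms of the two invariants through the Weyl-scalar value** `z = M/(r − iq)³`
(`q = a cos θ`): `M² Re (r + iq)⁶/(r² + q²)⁶ = Re z²` and `M³ Re (r + iq)⁹/(r² + q²)⁹ = Re z³`.
[folklore] -/
theorem re_sq_re_cube_div_cube (M r q : ℝ) (h : 0 < r ^ 2 + q ^ 2) :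
    M ^ 2 * (((r : ℂ) + (q : ℂ) * I) ^ 6).re / (r ^ 2 + q ^ 2) ^ 6 =
        (((M : ℂ) / ((r : ℂ) - (q : ℂ) * I) ^ 3) ^ 2).re ∧
      M ^ 3 * (((r : ℂ) + (q : ℂ) * I) ^ 9).re / (r ^ 2 + q ^ 2) ^ 9 =
        (((M : ℂ) / ((r : ℂ) - (q : ℂ) * I) ^ 3) ^ 3).re := by
  have hn : (r ^ 2 + q ^ 2) ≠ 0 := h.ne'
  rw [div_cube_eq M r q h]
  constructor
  · have e6 : (((r : ℂ) + (q : ℂ) * I) ^ 3) ^ 2 = ((r : ℂ) + (q : ℂ) * I) ^ 6 := by ring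
    rw [mul_pow, ← Complex.ofReal_pow, e6, Complex.re_ofReal_mul]
    field_simp
  · have e9 : (((r : ℂ) + (q : ℂ) * I) ^ 3) ^ 3 = ((r : ℂ) + (q : ℂ) * I) ^ 9 := by ring
    rw [mul_pow, ← Complex.ofReal_pow, e9, Complex.re_ofReal_mul]
    field_simp

/-- **The Weyl-scalar values of the sub-extremal exterior are bounded**: `‖M/(r − iq)³‖ ≤ M/r₊³`
for `r ≥ r₊ > 0`, `M ≥ 0`. [folklore] -/
theorem norm_div_cube_le {M r q r₀ : ℝ} (hM : 0 ≤ M) (hr₀ : 0 < r₀) (hr : r₀ ≤ r) :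
    ‖(M : ℂ) / ((r : ℂ) - (q : ℂ) * I) ^ 3‖ ≤ M / r₀ ^ 3 := by
  have hw : r₀ ≤ ‖(r : ℂ) - (q : ℂ) * I‖ := by
    have h1 := Complex.re_le_norm ((r : ℂ) - (q : ℂ) * I)
    have h2 : ((r : ℂ) - (q : ℂ) * I).re = r := by simp
    linarith
  rw [norm_div, norm_pow, Complex.norm_real, Real.norm_eq_abs, abs_of_nonneg hM]
  have h3 : r₀ ^ 3 ≤ ‖(r : ℂ) - (q : ℂ) * I‖ ^ 3 := by gcongr
  exact div_le_div_of_nonneg_left hM (by positivity) h3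

/-- **The endgame**: a bounded complex sequence `z n` whose `(Re z², Re z³)` converge to those of
a target `t` with `Re t² < 0`, but which stays `ε`-far from both `t` and `conj t`, does not exist
(Bolzano–Weierstrass, continuity, `eq_or_eq_conj_of_re_sq_of_re_cube`). [folklore] -/
theorem false_of_tendsto_re_sq_re_cube {z : ℕ → ℂ} {t : ℂ} {C ε : ℝ} (hC : ∀ n, ‖z n‖ ≤ C)
    (ht : (t ^ 2).re < 0) (hε : 0 < ε) (h1 : ∀ n, ε ≤ ‖z n - t‖)
    (h2 : ∀ n, ε ≤ ‖z n - (starRingEnd ℂ) t‖)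
    (hsq : Tendsto (fun n ↦ ((z n) ^ 2).re) atTop (𝓝 ((t ^ 2).re)))
    (hcube : Tendsto (fun n ↦ ((z n) ^ 3).re) atTop (𝓝 ((t ^ 3).re))) : False := by
  obtain ⟨w, -, φ, hφ, hw⟩ := tendsto_subseq_of_bounded (Metric.isBounded_closedBall (x := (0 : ℂ))
    (r := C)) (x := z) fun n ↦ by simpa using hC n
  have hsq' : ((w ^ 2).re) = (t ^ 2).re := by
    have h1 : Tendsto (fun n ↦ ((z (φ n)) ^ 2).re) atTop (𝓝 ((w ^ 2).re)) :=
      (Complex.continuous_re.tendsto _).comp ((hw.pow 2))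
    exact tendsto_nhds_unique h1 (hsq.comp hφ.tendsto_atTop)
  have hcube' : ((w ^ 3).re) = (t ^ 3).re := by
    have h1 : Tendsto (fun n ↦ ((z (φ n)) ^ 3).re) atTop (𝓝 ((w ^ 3).re)) :=
      (Complex.continuous_re.tendsto _).comp ((hw.pow 3))
    exact tendsto_nhds_unique h1 (hcube.comp hφ.tendsto_atTop)
  have hfar1 : ε ≤ ‖w - t‖ :=
    ge_of_tendsto ((continuous_norm.tendsto _).comp (hw.sub_const t)) (Eventually.of_forall
      fun n ↦ h1 (φ n))
  have hfar2 : ε ≤ ‖w - (starRingEnd ℂ) t‖ :=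
    ge_of_tendsto ((continuous_norm.tendsto _).comp (hw.sub_const _)) (Eventually.of_forall
      fun n ↦ h2 (φ n))
  rcases eq_or_eq_conj_of_re_sq_of_re_cube ht hsq' hcube' with h | h
  · rw [h, sub_self, norm_zero] at hfar1
    linarith
  · rw [h, sub_self, norm_zero] at hfar2
    linarith

end PhaseAlgebra

end WeylPhase

end Literature.Geometry.Lorentzian

end
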